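import Summits.HodgeConjecture.HodgeConjecture.Theorems.F0P6aStubFROB
import HarnessLib
import HarnessLib.Audit.LibrarySuggestionsDenyListCruxes
import Summits.HodgeConjecture.HodgeConjecture.Cruxes.HLiu418.Lines.F0_P6a_DatumOfInputs

/-! Import notes («M-142a» (A): canonical bare header; the per-import commentary lives here):
* `Summits.HodgeConjecture.HodgeConjecture.Theorems.F0P6aStubFROB` — ★ twin (LAST of 3 parts; parts 1–2 `…Theorems.F0P6aStubFROBStubs` → `…Theorems.F0P6aStubFROBCanSP` ride the import) of tree `Lines/F0_P6a_StubFROB.lean` f9174234eccff5e5 (522 l.)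
* `Summits.HodgeConjecture.HodgeConjecture.Cruxes.HLiu418.Lines.F0_P6a_DatumOfInputs` — D-LINE hub (by then itself the ★-Defs SHIM + sockets, K5-H2) — for the junction certificate below -/

/-! # F0_P6a_StubFROB — NEXT EDITION = SHIM (★ re-home, IMPORT-ONLY; K6 L3 column, dealer LA3-plan (g5) PLAN v2 ∕ set of record v1k + cuts [d]∕[d″] + the «M-150j»
early split ×3 (LEAD F0P6-plan (g7) 03:40Z 09-03), writer LA3-plan (g6)).  Of the 16 declaration commands of this workfile (tree ED. 5 f9174234eccff5e5, 522 l.: 15 named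
+ the junction `example`; namespace `Summit.HodgeConjecture.HodgeConjecture.Cruxes.HLiu418.F0P6aStubFROB` KEPT ⇒ identical fully-qualified names), 13 named now live in ★
`Theorems/F0P6aStubFROBStubs.lean` (p853473) {`frobIdealOf`, `frobIdealOf_mul_eq`, `FrobPin₀`, `subOf_eq_of_isEtaleOf`, `canSP_of_laws`, `stub_COV0`, `stub_TWISTCOVER0`}
→ ★ `Theorems/F0P6aStubFROBCanSP.lean` (p853564) {`stub_QUOTWD`, `stub_CANSP`, `roof0_of_cansp_geo`} → ★ `Theorems/F0P6aStubFROB.lean` (p853574) {`stub_ROOFGEO`, `stub_ROOF0`,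
`stubFROB_of_parts`} — the tree bytes split ×3 at command-block seams (tree :300∕:301 and :370∕:371; part 1 = the prefix with no reader of ★ `Theorems.F0P6aStubRHO1`,
which is imported from part 2 on; sections re-opened and their `variable`∕`open`∕`set_option` lines replayed verbatim in parts 2–3), with its `Lines/` imports switched
to their ★ re-homes, 0 statement bytes changed; the junction `example` moved HERE (below).  The other TWO named — `two_le_pChar_pow_fDeg` ([d], gate `dedup.landed` at
the leaf dry-run, LA3-p03 (g7) 00:35Z 09-03) and `eq_kerFOf_or_isEtaleOf` ([d″], LA3-r01 (g8) #66) — were DELETED in the ★ twin under the LEAD՚s «M-142e» class (d1) ∕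
«M-150h» (5) `dedup.landed` cure and resolve at their ★ homes `…Cruxes.HLiu418.F0P6aLineSpecialisation.two_le_pChar_pow_fDeg` (`Theorems/F0P6aLineSpecialisationLayer.lean`
:228, p852966; the bound `2 ≤ p ^ f` for the residue degree `f ≥ 1` of a prime `p` [cite: NeukirchANT1999, Ch. I (8.1)]) and `…Cruxes.HLiu418.F0P6aLineSpecialisation.eq_kerFOf_or_isEtaleOf`
(`Theorems/F0P6aLineSpecialisationLaws.lean` :323, p853055) — both typed WITHOUT the leaf՚s auto-included `[IsGalois ℚ F]` binder, hence strictly more general, and both in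
★ part 1՚s import closure (`Theorems.F0P6aLineSpecialisation`); their three call sites (`subOf_eq_of_isEtaleOf` ×1, `canSP_of_laws` ×2) are respelled to those ★ FQNs,
proofs otherwise byte-identical.  No tree file reads the two deleted names through this module (`rg -w` over `Cruxes/HLiu418/Lines` + `Theorems`, 03:45Z 09-03: 0 readers
outside this leaf; the only `Lines` importer, MAIN `Lines/F0_P6a_ModuliDatum.lean`, reads `stubFROB_of_parts` only (×4), re-homed in ★ part 3) ⇒ CLOSURE-NAMES contribution
of the cuts = ∅ and nothing to alias.  This file only imports the last part (transitively all three), so the module `…Cruxes.HLiu418.Lines.F0_P6a_StubFROB` keeps serving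
every surviving name to its importers (MAIN switches to the ★ module in its own twin ∕ shim, LAST WAVE).  It declares nothing.  Edition history stays in the line card
`Lines/F0_P6a_StubFROB.md` and git; future changes are ★-side proposals on the `Theorems/` parts.  HC_CM is proved only modulo the 7 printed citations (2 remaining named
inputs hLiu418 = stmt-HodgeConjecture-24832, h413 = stmt-HodgeConjecture-24833) until rung 0 closes; count-neutral (0 `sorry`, 0 socket, 0 declaration). -/

/-- JUNCTION CERTIFICATE (kept Lines-side; LA3-r01 (g6) «#53» (4), LA-ref2 #15a Q3): the ★ head IS the tree socket `stub_FROB`, type for type — this elaborates iff ONE copy of the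
D-LINE carriers is in the environment, i.e. the hub `Lines.F0_P6a_DatumOfInputs` is already the ★-Defs shim when this shim is written (forced order H2 ★ + hub shim → … → W6 ★ → leaf shim). -/
example : type_of% @Summit.HodgeConjecture.HodgeConjecture.Cruxes.HLiu418.F0P6aDatumOfInputs.stub_FROB :=
  @Summit.HodgeConjecture.HodgeConjecture.Cruxes.HLiu418.F0P6aStubFROB.stubFROB_of_parts
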